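import Literature.Probability.Percolation.AdjExtR
import Literature.Probability.Percolation.ArmSeparationSepInitFourAdj
import HarnessLib

/-!
# The initial estimate of the adjacent four-arm scheme on the sides `0, 1 | 3, 4`, at `p`

Topic `Literature/Probability/Percolation`; family `crit-perc` / near-critical percolation on `𝕋`.
A brick of the near-critical arm-separation theorem for four arms in the ADJACENT colour
arrangement (P. Nolin, EJP 13 (2008), Thm. 11, `j = 4`, `σ = BBWW` [arXiv 0711.4948: Thm. 10];
§4.3 Prop. 14, §4.4 first scale): at bounded ratio the landed event of the adjacent landing,
`extFourAdjR m N` (sides `0, 1` open read through `ρ¹`, `3, 4` closed read through `ρ³` of the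
complement), has probability bounded below, `P_p(extFourAdjR m N) ≥ (c⁵)⁴` for `1100 ≤ m`,
`2m ≤ N ≤ 10m`: the explicit fenced open arm `sepInitArm m N` read through the rotations
`ρ⁰, ρ¹` for `ω` and `ρ³, ρ⁴` for `ωᶜ`; the four rotated supports lie in the four pairwise disjoint
open cones of the sides `0, 1, 3, 4`, so the two arms of each colour are disjoint and the four events
are independent. The twin of `ArmSeparationSepInitFourAdj.lean` (sides `0, 2 | 3, 5`).

* `sepInitArm_pair_subset_extOpenDuoR` — the explicit arm through `ρ⁰, ρ¹` is a landed open pair;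
* `pow_le_real_extFourAdjR_at` — the estimate.

Everything here is proved; no named facts are introduced.

## References

* P. Nolin, Near-critical percolation in two dimensions, *Electron. J. Probab.* 13 (2008), §4.3
  Prop. 12 (proof) and Prop. 14, §4.4 (arXiv 0711.4948: Prop. 11, Prop. 13, proof of Thm. 10), σ = BBWW [Nolin2008].
-/

noncomputable section

open MeasureTheory Set

namespace Literature.Probability.Percolation

open LatticeModels

/-- **The explicit arm through `ρ⁰` and `ρ¹` gives two DISJOINT landed open arms on the sides `0`,
`1`**: the confining sets are the support of the explicit arm and its `ρ¹`-image, disjoint because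
they lie in the open cones of their sides. [cite: Nolin2008, §4.3 Prop. 14 (arXiv 0711.4948: Prop. 13), σ = BBWW] -/
theorem sepInitArm_pair_subset_extOpenDuoR {m N : ℕ} (hm : 1100 ≤ m) (hmN : 2 * m ≤ N) :
    sepInitArm m N ∩ {ω | rotConfig 1 ω ∈ sepInitArm m N} ⊆ extOpenDuoR m N := by
  rintro ω ⟨h0, h1⟩
  simp only [Set.mem_setOf_eq] at h1
  obtain ⟨F, hF⟩ : ∃ F : Set (Site 2), F = ↑(sepInitArmFinset m N) := ⟨_, rfl⟩
  have hFm : ∀ {v : Site 2}, v ∈ F → v ∈ sepInitArmFinset m N := fun hv => by rw [hF] at hv; exact Finset.mem_coe.1 hv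
  have dA := determinedBy_sepInitArm m N
  rw [determinedBy_iff] at dA
  refine ⟨F, triRotIsoPow 1 '' F, ?_, ?_, ?_⟩
  · rw [Set.disjoint_left]
    rintro v hv ⟨u, hu, rfl⟩
    have c1 := sepInitArmFinset_cone (by omega) hmN (hFm hv)
    have c2 := sepInitArmFinset_cone (by omega) hmN (hFm hu)
    obtain ⟨f10, f11⟩ := rot1_apply u
    rw [f10, f11] at c1
    omega
  · refine sepOpenArm_subset_extOpenArm hmN (sepInitArm_subset_sepOpenArm hm hmN ((dA (ω ∩ F) ω ?_).2 h0))
    rw [hF, Set.inter_assoc, Set.inter_self]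
  · rw [rotConfig_inter_image]
    refine sepOpenArm_subset_extOpenArm hmN (sepInitArm_subset_sepOpenArm hm hmN ((dA (rotConfig 1 ω ∩ F) (rotConfig 1 ω) ?_).2 h1))
    rw [hF, Set.inter_assoc, Set.inter_self]

/-- **The initial estimate of the adjacent scheme on the sides `0, 1 | 3, 4`, at `p`**: with the RSW
input `hrsw` at `p` and at `1 - p` (aspect ratio `ρ ≥ 1024`, heights `≤ Ncap`),
`P_p(extFourAdjR m N) ≥ (c⁵)⁴` for `1100 ≤ m`, `2m ≤ N ≤ 10 m`, `N ≤ Ncap`. [cite: Nolin2008, §4.3 Prop. 14, §4.4 (arXiv 0711.4948: Prop. 13; proof of Thm. 10, first scale), σ = BBWW] -/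
theorem pow_le_real_extFourAdjR_at (p : unitInterval) {c : ℝ} {ρ Ncap : ℕ}
    (hrsw : ∀ q : unitInterval, (q = p ∨ q = unitInterval.symm p) →
      ∀ k : ℕ, 1 ≤ ⌊(ρ : ℝ) * k⌋₊ → k ≤ Ncap → c ≤ triLRCrossingProb q ⌊(ρ : ℝ) * k⌋₊ k)
    (hρ : 1024 ≤ ρ) (hc : 0 ≤ c) {m N : ℕ} (hm : 1100 ≤ m) (hmN : 2 * m ≤ N) (hN : N ≤ 10 * m) (hcap : N ≤ Ncap) :
    (c ^ 5) ^ 4 ≤ (triSitePercolation p).real (extFourAdjR m N) := by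
  classical
  set A := sepInitArm m N with hA
  set F := sepInitArmFinset m N with hF
  have dA : DeterminedBy A ↑F := determinedBy_sepInitArm m N
  have dAr : ∀ i, DeterminedBy {ω : SiteConfig (Site 2) | rotConfig i ω ∈ A} ↑(F.image (triRotIsoPow i)) := fun i => by
    rw [Finset.coe_image]; exact determinedBy_preimage_rotConfig i dA
  have dArc : ∀ i, DeterminedBy {ω : SiteConfig (Site 2) | rotConfig i ωᶜ ∈ A} ↑(F.image (triRotIsoPow i)) := fun i => by
    have h2 : {ω : SiteConfig (Site 2) | rotConfig i ωᶜ ∈ A} =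
        {ω : SiteConfig (Site 2) | ωᶜ ∈ {χ : SiteConfig (Site 2) | rotConfig i χ ∈ A}} := by
      ext ω; simp only [Set.mem_setOf_eq]
    rw [h2]; exact DeterminedBy.preimage_compl' (dAr i)
  have cone := fun {v : Site 2} (hv : v ∈ F) => sepInitArmFinset_cone (by omega) hmN hv
  -- pairwise disjointness of the rotated supports (cones of the sides `0, 1, 3, 4`)
  have disj : ∀ i j : ℕ, i ≠ j → (i = 0 ∨ i = 1 ∨ i = 3 ∨ i = 4) → (j = 0 ∨ j = 1 ∨ j = 3 ∨ j = 4) →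
      Disjoint (F.image (triRotIsoPow i)) (F.image (triRotIsoPow j)) := by
    intro i j hij hi hj
    rw [Finset.disjoint_left]
    intro v hv hv'
    rw [Finset.mem_image] at hv hv'
    obtain ⟨u, hu, rfl⟩ := hv
    obtain ⟨w, hw, huw⟩ := hv'
    have cu := cone hu
    have cw := cone hw
    obtain ⟨u00, u01, u10, u11, -, -, u30, u31, u40, u41, -, -⟩ := rot_apply_formula u
    obtain ⟨w00, w01, w10, w11, -, -, w30, w31, w40, w41, -, -⟩ := rot_apply_formula w
    have e0 := congrFun huw 0
    have e1 := congrFun huw 1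
    rcases hi with rfl | rfl | rfl | rfl <;> rcases hj with rfl | rfl | rfl | rfl <;>
      first
        | exact absurd rfl hij
        | (simp only [u00, u01, u10, u11, u30, u31, u40, u41, w00, w01, w10, w11, w30, w31, w40, w41] at e0 e1; omega)
  -- the four rotated events and their probabilities
  have h5 : ∀ q : unitInterval, (q = p ∨ q = unitInterval.symm p) → c ^ 5 ≤ (triSitePercolation q).real A :=
    fun q hq => le_real_sepInitArm_at q (hrsw q hq) hρ hc hm hmN hN hcap
  have hA0 : {ω : SiteConfig (Site 2) | rotConfig 0 ω ∈ A} = A := by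
    ext ω; simp only [Set.mem_setOf_eq]
    have : rotConfig 0 ω = ω := by ext v; rw [mem_rotConfig]; rfl
    rw [this]
  have r1 : (triSitePercolation p).real {ω : SiteConfig (Site 2) | rotConfig 1 ω ∈ A} = (triSitePercolation p).real A :=
    real_preimage_rotConfig p 1 A
  have rc : ∀ i, (triSitePercolation p).real {ω : SiteConfig (Site 2) | rotConfig i ωᶜ ∈ A} =
      (triSitePercolation (unitInterval.symm p)).real A := fun i => by
    have h2 : {ω : SiteConfig (Site 2) | rotConfig i ωᶜ ∈ A} = compl ⁻¹' {χ : SiteConfig (Site 2) | rotConfig i χ ∈ A} := by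
      ext ω; simp only [Set.mem_setOf_eq, Set.mem_preimage]
    rw [h2]
    unfold triSitePercolation
    rw [sitePercolation_real_preimage_compl]
    exact real_preimage_rotConfig (unitInterval.symm p) i A
  -- independence
  have dA0 : DeterminedBy A ↑(F.image (triRotIsoPow 0)) := by have h := dAr 0; rwa [hA0] at h
  have i01 := sitePercolation_real_inter_of_disjoint p dA0 (dAr 1)
    (disj 0 1 (by norm_num) (Or.inl rfl) (Or.inr (Or.inl rfl)))
  have d01 : DeterminedBy (A ∩ {ω : SiteConfig (Site 2) | rotConfig 1 ω ∈ A}) ↑(F.image (triRotIsoPow 0) ∪ F.image (triRotIsoPow 1)) := by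
    rw [Finset.coe_union]
    exact (dA0.mono Set.subset_union_left).inter ((dAr 1).mono Set.subset_union_right)
  have i013 := sitePercolation_real_inter_of_disjoint p d01 (dArc 3)
    (Finset.disjoint_union_left.2 ⟨disj 0 3 (by norm_num) (Or.inl rfl) (Or.inr (Or.inr (Or.inl rfl))),
      disj 1 3 (by norm_num) (Or.inr (Or.inl rfl)) (Or.inr (Or.inr (Or.inl rfl)))⟩)
  have d013 : DeterminedBy (A ∩ {ω : SiteConfig (Site 2) | rotConfig 1 ω ∈ A} ∩ {ω | rotConfig 3 ωᶜ ∈ A})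
      ↑(F.image (triRotIsoPow 0) ∪ F.image (triRotIsoPow 1) ∪ F.image (triRotIsoPow 3)) := by
    rw [Finset.coe_union]
    exact (d01.mono Set.subset_union_left).inter ((dArc 3).mono Set.subset_union_right)
  have i0134 := sitePercolation_real_inter_of_disjoint p d013 (dArc 4)
    (Finset.disjoint_union_left.2 ⟨Finset.disjoint_union_left.2
      ⟨disj 0 4 (by norm_num) (Or.inl rfl) (Or.inr (Or.inr (Or.inr rfl))), disj 1 4 (by norm_num) (Or.inr (Or.inl rfl)) (Or.inr (Or.inr (Or.inr rfl)))⟩,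
      disj 3 4 (by norm_num) (Or.inr (Or.inr (Or.inl rfl))) (Or.inr (Or.inr (Or.inr rfl)))⟩)
  -- the inclusion
  have hsub : A ∩ {ω : SiteConfig (Site 2) | rotConfig 1 ω ∈ A} ∩ {ω | rotConfig 3 ωᶜ ∈ A} ∩ {ω | rotConfig 4 ωᶜ ∈ A} ⊆
      extFourAdjR m N := by
    rintro ω ⟨⟨⟨h0, h1⟩, h3⟩, h4⟩
    refine ⟨sepInitArm_pair_subset_extOpenDuoR hm hmN ⟨h0, h1⟩, ?_⟩
    simp only [Set.mem_setOf_eq] at h3 h4 ⊢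
    refine sepInitArm_pair_subset_extOpenDuoR hm hmN ⟨h3, ?_⟩
    simp only [Set.mem_setOf_eq]
    rw [rotConfig_rotConfig]; exact h4
  have hp := h5 p (Or.inl rfl)
  have hq := h5 (unitInterval.symm p) (Or.inr rfl)
  have hc5 : 0 ≤ c ^ 5 := pow_nonneg hc 5
  unfold triSitePercolation at r1 rc hp hq i01 i013 i0134 ⊢
  calc (c ^ 5) ^ 4 = c ^ 5 * c ^ 5 * c ^ 5 * c ^ 5 := by ring
    _ ≤ (sitePercolation (Site 2) p).real A * (sitePercolation (Site 2) p).real {ω : SiteConfig (Site 2) | rotConfig 1 ω ∈ A} *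
          (sitePercolation (Site 2) p).real {ω : SiteConfig (Site 2) | rotConfig 3 ωᶜ ∈ A} *
          (sitePercolation (Site 2) p).real {ω : SiteConfig (Site 2) | rotConfig 4 ωᶜ ∈ A} := by
        rw [r1, rc 3, rc 4]
        have h0 : ∀ s, 0 ≤ (sitePercolation (Site 2) p).real s := fun s => measureReal_nonneg
        have h0' : ∀ s, 0 ≤ (sitePercolation (Site 2) (unitInterval.symm p)).real s := fun s => measureReal_nonneg
        have t2 := mul_le_mul hp hp hc5 (h0 _)
        have t3 := mul_le_mul t2 hq hc5 (mul_nonneg (h0 _) (h0 _))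
        exact mul_le_mul t3 hq hc5 (mul_nonneg (mul_nonneg (h0 _) (h0 _)) (h0' _))
    _ = (sitePercolation (Site 2) p).real (A ∩ {ω : SiteConfig (Site 2) | rotConfig 1 ω ∈ A} ∩ {ω | rotConfig 3 ωᶜ ∈ A} ∩
          {ω | rotConfig 4 ωᶜ ∈ A}) := by rw [i0134, i013, i01]
    _ ≤ (sitePercolation (Site 2) p).real (extFourAdjR m N) := measureReal_mono hsub (measure_ne_top _ _)

end Literature.Probability.Percolation
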